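import Literature.Computability.QuantumComplexity.JonesLoopCount
import HarnessLib

/-!
# Deleting an untouched pair of strands does not change the AJL ratio (`k = 5`)

Topic `Literature/Computability/QuantumComplexity`; a step in the discharge of
`ajl_jonesApproxProblem_mem_PromiseBQP` (`JonesInBQP.lean`). In the tree's encoding of the
Aharonov–Jones–Landau problem (`jonesApproxProblem`, `JonesPolynomial.lean`) the number of strands
`n` and the generator indices are written in *binary*, so a polynomial-time algorithm must first
discard the strands that no crossing touches: if no letter of the word `b` touches the strands
`2l, 2l+1` (i.e. no generator index lies in `{2l−1, 2l, 2l+1}`), these two strands and the two plat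
caps joining them form a separate unknotted circle of the plat closure, the Kauffman bracket loses a
factor `d` (`⟨L ⊔ ◯⟩ = d⟨L⟩`, Kauffman 1987) and so does the normalisation `d^{n/2−1}`, whence
`ajlRatio 5 n b = ajlRatio 5 (n−2) b'` for the re-indexed word `b'`.

We prove this on the *matrix side*, through the path-model identity
`ajlRatio k n b = |⟨α|φ(b)|α⟩|` (`ajlRatio_eq_norm`, `JonesLoopCount.lean`): inserting the detour
`10` (one step up, one step down) at the even time `2l` into every walk on `G_5` is an isometric
embedding `ins` of the `n`-step walk space into the `(n+2)`-step one (**at `k = 5` every walk is at an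
odd vertex `1` or `3` at even times, so the detour stays inside `G_5 = {1,2,3,4}`** —
`isGkPath_insPair_iff`; this is where `k = 5` is used), it maps `α_n = 1010…` to `α_{n+2}`, and it
intertwines the path-model generators `Φ_i ↦ Φ_{i'}` for the re-indexing `i' = i` (`i ≤ 2l−2`),
`i' = i + 2` (`i ≥ 2l`) of the generators not touching the new strands
(`ajlPhiC_expand_mulVec_pushIns`), hence the crossings and the words; so
`⟨α_{n+2}| φ(b') |α_{n+2}⟩ = ⟨α_n| φ(b) |α_n⟩` (`ajlBraidMatrix_expandWord_apply_alpha`) and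
**`ajlRatio_expandWord`**: `ajlRatio 5 (n+2) (expandWord l b) = ajlRatio 5 n b` (even `n ≥ 2`).
For the digest of the algorithm the statement is also given in the deleting direction
(`compressWord`, `ajlRatio_eq_ajlRatio_compressWord`): a word on `n + 2` strands none of whose letters
touches the strands `2l, 2l+1` has the ratio of its compression.

## References

* D. Aharonov, V. Jones, Z. Landau, Algorithmica 55 (2009) = arXiv:quant-ph/0511096, §3.1
  (walks on `G_k`, eq. (3.1)), Thm. 3.2 [AharonovJonesLandau2009].
* L. H. Kauffman, *State models and the Jones polynomial*, Topology 26 (1987) 395–407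
  (`⟨L ⊔ ◯⟩ = d ⟨L⟩`) [Kauffman1987].
-/

noncomputable section

namespace Literature.Computability.QuantumComplexity

open Matrix Complex Finset

variable {n : ℕ}

/-! ### Bits as functions on `ℕ`; positions as range sums -/

/-- The bits of a string as a function on `ℕ` (`false` beyond the length). [folklore] -/
def bitsFn (p : Cryptography.QReg n) (t : ℕ) : Bool := if h : t < n then p ⟨t, h⟩ else false

/-- `bitsFn` at an index in range. [folklore] -/
theorem bitsFn_of_lt (p : Cryptography.QReg n) {t : ℕ} (h : t < n) : bitsFn p t = p ⟨t, h⟩ := by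
  rw [bitsFn, dif_pos h]

/-- Two strings are equal iff their bit functions are. [folklore] -/
theorem eq_of_bitsFn_eq {p q : Cryptography.QReg n} (h : ∀ t < n, bitsFn p t = bitsFn q t) : p = q := by
  funext t
  have := h t t.2
  rwa [bitsFn_of_lt p t.2, bitsFn_of_lt q t.2] at this

/-- **Positions as range sums**: `z_j = 1 + Σ_{t < j, t < n} ε(p_t)`. [cite: AharonovJonesLandau2009, Def. 3.2] -/
theorem pathPos_eq_sum_range (p : Cryptography.QReg n) (j : ℕ) :
    pathPos p j = 1 + ∑ t ∈ Finset.range j, if t < n then stepSign (bitsFn p t) else 0 := by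
  induction j with
  | zero => simp
  | succ j ih =>
    rw [Finset.sum_range_succ, ← add_assoc, ← ih]
    by_cases hj : j < n
    · rw [if_pos hj, pathPos_succ p hj, bitsFn_of_lt p hj]
    · rw [if_neg hj, add_zero]
      unfold pathPos
      congr 1
      refine Finset.sum_congr rfl fun t _ => ?_
      have ht : (t : ℕ) < j := by omega
      rw [if_pos ht, if_pos (Nat.lt_succ_of_lt ht)]

/-- At `k = 5`, positions at even times are odd (`1` or `3`), so one more step up stays in `G_5`.
[cite: AharonovJonesLandau2009, §3.1] -/
theorem pathPos_even_add_one_le {p : Cryptography.QReg n} (hp : IsGkPath 5 n p) {j : ℕ} (hj : j ≤ n) (he : Even j) :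
    pathPos p j + 1 + 1 ≤ 5 := by
  -- parity: `z_j ≡ 1 + j (mod 2)`
  have hpar : ∀ j ≤ n, ∃ c : ℤ, pathPos p j = 1 + j - 2 * c := by
    intro j hj
    induction j with
    | zero => exact ⟨0, by simp⟩
    | succ j ih =>
      obtain ⟨c, hc⟩ := ih (by omega)
      rw [pathPos_succ _ (show j < n by omega), hc]
      cases p ⟨j, by omega⟩
      · exact ⟨c + 1, by simp; ring⟩
      · exact ⟨c, by simp; ring⟩
  obtain ⟨c, hc⟩ := hpar j hj
  obtain ⟨b1, b2⟩ := hp j hj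
  obtain ⟨e, rfl⟩ := he
  omega

/-! ### Inserting the detour `10` at time `2l` -/

section Insert

variable (l : ℕ)

/-- **Insertion of the detour `10` at the even time `2l`**: the string `p₀ … p_{2l−1} 1 0 p_{2l} … p_{n−1}`
(strands `2l, 2l+1` of the longer braid carry no crossing; in the plat closure they form a separate
circle). [cite: AharonovJonesLandau2009, §3.1] -/
def insPair (hl : 2 * l ≤ n) (p : Cryptography.QReg n) : Cryptography.QReg (n + 2) := fun t =>
  if h1 : (t : ℕ) < 2 * l then p ⟨t, by omega⟩
  else if h2 : (t : ℕ) = 2 * l then true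
  else if h3 : (t : ℕ) = 2 * l + 1 then false
  else p ⟨(t : ℕ) - 2, by omega⟩

variable {l} (hl : 2 * l ≤ n)
include hl

/-- The bits of the inserted string. [folklore] -/
theorem bitsFn_insPair (p : Cryptography.QReg n) (t : ℕ) :
    bitsFn (insPair l hl p) t =
      if t < 2 * l then bitsFn p t else if t = 2 * l then true else if t = 2 * l + 1 then false else bitsFn p (t - 2) := by
  by_cases ht : t < n + 2
  · rw [bitsFn_of_lt _ ht, insPair]
    simp only
    split_ifs with h1 h2 h3
    · rw [bitsFn_of_lt]
    · rfl
    · rfl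
    · rw [bitsFn_of_lt]
  · rw [bitsFn, dif_neg ht, if_neg (by omega), if_neg (by omega), if_neg (by omega), bitsFn, dif_neg (by omega)]

/-- `insPair` is injective. [folklore] -/
theorem insPair_injective : Function.Injective (insPair l hl : Cryptography.QReg n → Cryptography.QReg (n + 2)) := by
  intro p q h
  apply eq_of_bitsFn_eq
  intro t ht
  by_cases h1 : t < 2 * l
  · have := congrArg (fun r => bitsFn r t) h
    simp only [bitsFn_insPair hl, if_pos h1] at this
    exact this
  · have := congrArg (fun r => bitsFn r (t + 2)) h
    simp only [bitsFn_insPair hl, if_neg (show ¬ t + 2 < 2 * l by omega), if_neg (show t + 2 ≠ 2 * l by omega),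
      if_neg (show t + 2 ≠ 2 * l + 1 by omega), Nat.add_sub_cancel] at this
    exact this

/-- **Positions of the inserted walk before the detour** (`j ≤ 2l`): unchanged. [folklore] -/
theorem pathPos_insPair_of_le (p : Cryptography.QReg n) {j : ℕ} (hj : j ≤ 2 * l) :
    pathPos (insPair l hl p) j = pathPos p j := by
  rw [pathPos_eq_sum_range, pathPos_eq_sum_range]
  congr 1
  refine Finset.sum_congr rfl fun t ht => ?_
  rw [Finset.mem_range] at ht
  rw [bitsFn_insPair hl, if_pos (by omega), if_pos (by omega), if_pos (by omega)]

/-- **Position right after the up-step of the detour**: `z_{2l} + 1`. [folklore] -/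
theorem pathPos_insPair_mid (p : Cryptography.QReg n) :
    pathPos (insPair l hl p) (2 * l + 1) = pathPos p (2 * l) + 1 := by
  rw [pathPos_succ _ (show 2 * l < n + 2 by omega), pathPos_insPair_of_le hl p le_rfl]
  congr 1
  have : insPair l hl p ⟨2 * l, by omega⟩ = true := by
    simp [insPair]
  rw [this, stepSign_true]

/-- **Positions after the detour** (`j ≥ 2l`): `z'_{j+2} = z_j` (the two steps cancel). [folklore] -/
theorem pathPos_insPair_add_two (p : Cryptography.QReg n) {j : ℕ} (hj : 2 * l ≤ j) :
    pathPos (insPair l hl p) (j + 2) = pathPos p j := by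
  rw [pathPos_eq_sum_range, pathPos_eq_sum_range]
  congr 1
  -- split `range (j+2)` as `range (2l) ∪ {2l, 2l+1} ∪ [2l+2, j+2)` and `range j` as `range (2l) ∪ [2l, j)`
  obtain ⟨e, rfl⟩ := Nat.exists_eq_add_of_le hj
  rw [show 2 * l + e + 2 = (2 * l + 2) + e by ring,
    Finset.sum_range_add (fun t => if t < n + 2 then stepSign (bitsFn (insPair l hl p) t) else (0 : ℤ)) (2 * l + 2) e,
    Finset.sum_range_add (fun t => if t < n then stepSign (bitsFn p t) else (0 : ℤ)) (2 * l) e,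
    Finset.sum_range_succ _ (2 * l + 1), Finset.sum_range_succ _ (2 * l)]
  have h0 : ∀ t ∈ Finset.range (2 * l), (if t < n + 2 then stepSign (bitsFn (insPair l hl p) t) else (0 : ℤ)) =
      if t < n then stepSign (bitsFn p t) else 0 := by
    intro t ht
    rw [Finset.mem_range] at ht
    rw [bitsFn_insPair hl, if_pos ht]
    by_cases h : t < n
    · rw [if_pos (by omega), if_pos h]
    · rw [if_neg (by omega), if_neg h]
  rw [Finset.sum_congr rfl h0]
  have h1 : (if 2 * l < n + 2 then stepSign (bitsFn (insPair l hl p) (2 * l)) else (0 : ℤ)) = 1 := by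
    rw [if_pos (by omega), bitsFn_insPair hl, if_neg (lt_irrefl _), if_pos rfl, stepSign_true]
  have h2 : (if 2 * l + 1 < n + 2 then stepSign (bitsFn (insPair l hl p) (2 * l + 1)) else (0 : ℤ)) = -1 := by
    rw [if_pos (by omega), bitsFn_insPair hl, if_neg (by omega), if_neg (by omega), if_pos rfl, stepSign_false]
  rw [h1, h2]
  have h3 : ∀ t ∈ Finset.range e, (if 2 * l + 2 + t < n + 2 then stepSign (bitsFn (insPair l hl p) (2 * l + 2 + t)) else (0 : ℤ)) =
      if 2 * l + t < n then stepSign (bitsFn p (2 * l + t)) else 0 := by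
    intro t _
    have e1 : bitsFn (insPair l hl p) (2 * l + 2 + t) = bitsFn p (2 * l + t) := by
      rw [bitsFn_insPair hl, if_neg (by omega), if_neg (by omega), if_neg (by omega),
        show 2 * l + 2 + t - 2 = 2 * l + t by omega]
    rw [e1]
    by_cases h : 2 * l + t < n
    · rw [if_pos (by omega), if_pos h]
    · rw [if_neg (by omega), if_neg h]
  rw [Finset.sum_congr rfl h3]
  ring

/-- **`k = 5`: the inserted string is a walk on `G_5` iff the original one is.**
[cite: AharonovJonesLandau2009, Def. 3.1 and §3.1] -/
theorem isGkPath_insPair_iff (p : Cryptography.QReg n) : IsGkPath 5 (n + 2) (insPair l hl p) ↔ IsGkPath 5 n p := by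
  constructor
  · intro h j hj
    rcases Nat.lt_or_ge j (2 * l + 1) with h1 | h1
    · rw [← pathPos_insPair_of_le hl p (by omega)]; exact h j (by omega)
    · rw [← pathPos_insPair_add_two hl p (by omega)]; exact h (j + 2) (by omega)
  · intro h j hj
    rcases Nat.lt_or_ge j (2 * l + 1) with h1 | h1
    · rw [pathPos_insPair_of_le hl p (by omega)]; exact h j (by omega)
    · rcases Nat.lt_or_ge j (2 * l + 2) with h2 | h2
      · obtain rfl : j = 2 * l + 1 := by omega
        rw [pathPos_insPair_mid hl p]
        have := h (2 * l) hl
        exact ⟨by omega, pathPos_even_add_one_le h hl ⟨l, by ring⟩⟩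
      · obtain ⟨j', rfl⟩ : ∃ j', j = j' + 2 := ⟨j - 2, by omega⟩
        rw [pathPos_insPair_add_two hl p (by omega)]; exact h j' (by omega)

/-- `α_{n+2}` is `α_n` with the detour inserted (`α = 1010…` at every even time). [cite: AharonovJonesLandau2009, §3.3] -/
theorem insPair_ajlAlpha : insPair l hl (ajlAlpha n) = ajlAlpha (n + 2) := by
  apply eq_of_bitsFn_eq
  intro t ht
  rw [bitsFn_insPair hl, bitsFn_of_lt _ ht]
  split_ifs with h1 h2 h3
  · rw [bitsFn_of_lt _ (show t < n by omega)]; rfl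
  · subst h2; simp [ajlAlpha]
  · subst h3; simp [ajlAlpha]
  · rw [bitsFn_of_lt _ (show t - 2 < n by omega)]
    simp only [ajlAlpha, decide_eq_decide]
    obtain ⟨t', rfl⟩ : ∃ t', t = t' + 2 := ⟨t - 2, by omega⟩
    simp [Nat.even_add]

end Insert

/-! ### Re-indexing the generators; the intertwining -/

section Expand

/-- The index of a generator of the shorter braid inside the longer one: generators left of the
new strands keep their index, the others move up by two. [folklore] -/
def expandIdx (l i : ℕ) : ℕ := if i < 2 * l then i else i + 2

/-- `expandIdx` on generator indices. [folklore] -/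
def expandGen (l : ℕ) (i : Fin (n - 1)) : Fin (n + 2 - 1) :=
  ⟨expandIdx l i, by have := i.2; unfold expandIdx; split_ifs <;> omega⟩

/-- The value of `expandGen`. [folklore] -/
@[simp] theorem expandGen_val (l : ℕ) (i : Fin (n - 1)) : (expandGen l i : ℕ) = expandIdx l i := rfl

/-- Deleting the bits `2l, 2l+1`. [folklore] -/
def delPair (l : ℕ) (y : Cryptography.QReg (n + 2)) : Cryptography.QReg n := fun t =>
  if (t : ℕ) < 2 * l then y ⟨t, by omega⟩ else y ⟨t + 2, by omega⟩

variable {l : ℕ} (hl : 2 * l ≤ n)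
include hl

/-- A bit of the inserted string, by position. [folklore] -/
theorem insPair_apply (p : Cryptography.QReg n) (T : Fin (n + 2)) :
    insPair l hl p T = (if (T : ℕ) < 2 * l then bitsFn p T else if (T : ℕ) = 2 * l then true
      else if (T : ℕ) = 2 * l + 1 then false else bitsFn p ((T : ℕ) - 2)) := by
  rw [← bitsFn_insPair hl p T, bitsFn_of_lt _ T.2]

/-- The inserted string at the first bit of a re-indexed generator. [folklore] -/
theorem insPair_genFst (p : Cryptography.QReg n) (i : Fin (n - 1)) :
    insPair l hl p (genFst (expandGen l i)) = p (genFst i) := by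
  have hi := i.2
  rw [insPair_apply hl]
  simp only [genFst_val, expandGen_val, expandIdx]
  split_ifs with h1 h2 h3 h4 <;> first | omega | (rw [bitsFn_of_lt _ (by omega)]; rfl)

/-- The inserted string at the second bit of a re-indexed generator not touching the new strands.
[folklore] -/
theorem insPair_genSnd (p : Cryptography.QReg n) (i : Fin (n - 1)) (hi2 : (i : ℕ) + 1 ≠ 2 * l) :
    insPair l hl p (genSnd (expandGen l i)) = p (genSnd i) := by
  have hi := i.2
  rw [insPair_apply hl]
  simp only [genSnd_val, expandGen_val, expandIdx]
  split_ifs with h1 h2 h3 h4 <;> first | omega | (rw [bitsFn_of_lt _ (by omega)]; rfl)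

/-- **Agreement off the generator bits corresponds under insertion** (for a generator not touching
the new strands). [folklore] -/
theorem agree_insPair_iff (q p : Cryptography.QReg n) (i : Fin (n - 1)) (hi2 : (i : ℕ) + 1 ≠ 2 * l) :
    (∀ T : Fin (n + 2), T ≠ genFst (expandGen l i) → T ≠ genSnd (expandGen l i) → insPair l hl q T = insPair l hl p T) ↔
      (∀ t : Fin n, t ≠ genFst i → t ≠ genSnd i → q t = p t) := by
  have hi := i.2
  constructor
  · intro h t h1 h2
    have ht1 : (t : ℕ) ≠ i := fun e => h1 (Fin.ext e)
    have ht2 : (t : ℕ) ≠ i + 1 := fun e => h2 (Fin.ext e)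
    by_cases hlt : (t : ℕ) < 2 * l
    · have := h ⟨t, by omega⟩ (fun e => by have := congrArg Fin.val e; simp [expandIdx] at this; split_ifs at this <;> omega)
        (fun e => by have := congrArg Fin.val e; simp [expandIdx] at this; split_ifs at this <;> omega)
      rw [insPair_apply hl, insPair_apply hl] at this
      simp only [hlt, if_true] at this
      rwa [bitsFn_of_lt _ t.2, bitsFn_of_lt _ t.2] at this
    · have := h ⟨t + 2, by omega⟩ (fun e => by have := congrArg Fin.val e; simp [expandIdx] at this; split_ifs at this <;> omega)
        (fun e => by have := congrArg Fin.val e; simp [expandIdx] at this; split_ifs at this <;> omega)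
      rw [insPair_apply hl, insPair_apply hl] at this
      simp only [show ¬ ((t : ℕ) + 2 < 2 * l) by omega, show (t : ℕ) + 2 ≠ 2 * l by omega,
        show (t : ℕ) + 2 ≠ 2 * l + 1 by omega, if_false, Nat.add_sub_cancel] at this
      rwa [bitsFn_of_lt _ t.2, bitsFn_of_lt _ t.2] at this
  · intro h T h1 h2
    have hT1 : (T : ℕ) ≠ expandIdx l i := fun e => h1 (Fin.ext e)
    have hT2 : (T : ℕ) ≠ expandIdx l i + 1 := fun e => h2 (Fin.ext e)
    simp only [expandIdx] at hT1 hT2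
    rw [insPair_apply hl, insPair_apply hl]
    split_ifs with c1 c2 c3
    · rw [bitsFn_of_lt _ (show (T : ℕ) < n by omega), bitsFn_of_lt _ (show (T : ℕ) < n by omega)]
      exact h _ (fun e => by have := congrArg Fin.val e; simp at this; split_ifs at hT1 hT2 <;> omega)
        (fun e => by have := congrArg Fin.val e; simp at this; split_ifs at hT1 hT2 <;> omega)
    · rfl
    · rfl
    · have hT := T.2
      rw [bitsFn_of_lt _ (show (T : ℕ) - 2 < n by omega), bitsFn_of_lt _ (show (T : ℕ) - 2 < n by omega)]
      exact h _ (fun e => by have := congrArg Fin.val e; simp at this; split_ifs at hT1 hT2 <;> omega)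
        (fun e => by have := congrArg Fin.val e; simp at this; split_ifs at hT1 hT2 <;> omega)

/-- **The support condition corresponds under insertion.** [cite: AharonovJonesLandau2009, §3.1 eq. (3.1)] -/
theorem phiSupport_insPair_iff (q p : Cryptography.QReg n) (i : Fin (n - 1)) (hi2 : (i : ℕ) + 1 ≠ 2 * l) :
    PhiSupport 5 (n + 2) (expandGen l i) (insPair l hl q) (insPair l hl p) ↔ PhiSupport 5 n i q p := by
  unfold PhiSupport
  rw [isGkPath_insPair_iff hl, isGkPath_insPair_iff hl, agree_insPair_iff hl q p i hi2, insPair_genFst hl,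
    insPair_genSnd hl p i hi2, insPair_genFst hl, insPair_genSnd hl q i hi2]

/-- The position before a re-indexed generator is the position before the original one. [folklore] -/
theorem pathPos_insPair_expandIdx (p : Cryptography.QReg n) (i : Fin (n - 1)) :
    pathPos (insPair l hl p) (expandIdx l i) = pathPos p i := by
  unfold expandIdx
  split_ifs with h
  · exact pathPos_insPair_of_le hl p h.le
  · exact pathPos_insPair_add_two hl p (by omega)

/-- **Entries of the re-indexed generator between inserted strings are the original entries.**
[cite: AharonovJonesLandau2009, §3.1 eq. (3.1)] -/
theorem ajlPhi_expand_insPair (q p : Cryptography.QReg n) (i : Fin (n - 1)) (hi2 : (i : ℕ) + 1 ≠ 2 * l) :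
    ajlPhi 5 (n + 2) (expandGen l i) (insPair l hl q) (insPair l hl p) = ajlPhi 5 n i q p := by
  rw [ajlPhi_apply, ajlPhi_apply]
  by_cases h : PhiSupport 5 n i q p
  · rw [if_pos ((phiSupport_insPair_iff hl q p i hi2).2 h), if_pos h, expandGen_val, pathPos_insPair_expandIdx hl,
      insPair_genFst hl, insPair_genFst hl]
  · rw [if_neg (fun h' => h ((phiSupport_insPair_iff hl q p i hi2).1 h')), if_neg h]

/-- A string carrying the detour `10` at `2l` is the insertion of its deletion. [folklore] -/
theorem insPair_delPair {y : Cryptography.QReg (n + 2)} (h1 : y ⟨2 * l, by omega⟩ = true) (h2 : y ⟨2 * l + 1, by omega⟩ = false) :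
    insPair l hl (delPair l y) = y := by
  funext T
  rw [insPair_apply hl]
  split_ifs with c1 c2 c3
  · rw [bitsFn_of_lt _ (show (T : ℕ) < n by omega), delPair, if_pos c1]
  · rw [← h1]; congr 1; exact Fin.ext c2.symm
  · rw [← h2]; congr 1; exact Fin.ext c3.symm
  · have hT := T.2
    rw [bitsFn_of_lt _ (show (T : ℕ) - 2 < n by omega)]
    simp only [delPair]
    rw [if_neg (show ¬ ((T : ℕ) - 2 < 2 * l) by omega)]
    congr 1; ext; dsimp only; omega

/-- **Off the range of the insertion the re-indexed generator vanishes against inserted strings**: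
a string in the support of such a column agrees with it on the untouched bits `2l, 2l+1`, hence
carries the detour. [folklore] -/
theorem ajlPhi_expand_eq_zero_of_not_range {y : Cryptography.QReg (n + 2)} (hy : y ∉ Set.range (insPair l hl))
    (p : Cryptography.QReg n) (i : Fin (n - 1)) (hi2 : (i : ℕ) + 1 ≠ 2 * l) :
    ajlPhi 5 (n + 2) (expandGen l i) y (insPair l hl p) = 0 := by
  rw [ajlPhi_apply, if_neg]
  intro h
  apply hy
  have hi := i.2
  have hagree := h.2.2.1
  have e1 : y ⟨2 * l, by omega⟩ = true := by
    have := hagree ⟨2 * l, by omega⟩ (fun e => by have := congrArg Fin.val e; simp [expandIdx] at this; split_ifs at this <;> omega)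
      (fun e => by have := congrArg Fin.val e; simp [expandIdx] at this; split_ifs at this <;> omega)
    rw [this, insPair_apply hl]; simp
  have e2 : y ⟨2 * l + 1, by omega⟩ = false := by
    have := hagree ⟨2 * l + 1, by omega⟩ (fun e => by have := congrArg Fin.val e; simp [expandIdx] at this; split_ifs at this <;> omega)
      (fun e => by have := congrArg Fin.val e; simp [expandIdx] at this; split_ifs at this <;> omega)
    rw [this, insPair_apply hl]; simp
  exact ⟨delPair l y, insPair_delPair hl e1 e2⟩

end Expand

/-! ### Push-forward along the insertion and the intertwining of the words -/

section Push

/-- `M |w⟩` evaluated at `x` is the entry `M x w` (the column lemma, restated to keep the import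
cone of this file small). [folklore] -/
theorem mulVec_basisState_apply' {m : ℕ} (M : Matrix (Cryptography.QReg m) (Cryptography.QReg m) ℂ)
    (w x : Cryptography.QReg m) : (M *ᵥ Cryptography.basisState w) x = M x w := by
  simp [Matrix.mulVec, dotProduct, Cryptography.basisState_apply]

variable {l : ℕ} (hl : 2 * l ≤ n)
include hl

/-- The push-forward of a vector on `n`-bit strings along the insertion (extension by zero off its
range). [folklore] -/
def pushIns (v : Cryptography.QReg n → ℂ) : Cryptography.QReg (n + 2) → ℂ := fun y =>
  ∑ p, if insPair l hl p = y then v p else 0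

/-- The push-forward at an inserted string. [folklore] -/
theorem pushIns_insPair (v : Cryptography.QReg n → ℂ) (q : Cryptography.QReg n) : pushIns hl v (insPair l hl q) = v q := by
  rw [pushIns, Finset.sum_eq_single q]
  · rw [if_pos rfl]
  · intro p _ hp
    rw [if_neg (fun h => hp (insPair_injective hl h))]
  · simp

/-- The push-forward vanishes off the range. [folklore] -/
theorem pushIns_of_not_range (v : Cryptography.QReg n → ℂ) {y : Cryptography.QReg (n + 2)} (hy : y ∉ Set.range (insPair l hl)) :
    pushIns hl v y = 0 :=
  Finset.sum_eq_zero fun p _ => by rw [if_neg (fun h => hy ⟨p, h⟩)]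

/-- Pairing against a push-forward is pairing along the insertion. [folklore] -/
theorem sum_mul_pushIns (f : Cryptography.QReg (n + 2) → ℂ) (v : Cryptography.QReg n → ℂ) :
    ∑ y, f y * pushIns hl v y = ∑ p, f (insPair l hl p) * v p := by
  simp only [pushIns, Finset.mul_sum, mul_ite, mul_zero]
  rw [Finset.sum_comm]
  refine Finset.sum_congr rfl fun p _ => ?_
  rw [Finset.sum_ite_eq Finset.univ (insPair l hl p), if_pos (Finset.mem_univ _)]

/-- The push-forward is additive. [folklore] -/
theorem pushIns_add (v w : Cryptography.QReg n → ℂ) : pushIns hl (v + w) = pushIns hl v + pushIns hl w := by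
  funext y
  simp only [pushIns, Pi.add_apply, ← Finset.sum_add_distrib]
  refine Finset.sum_congr rfl fun p _ => ?_
  split_ifs <;> simp

/-- The push-forward is homogeneous. [folklore] -/
theorem pushIns_smul (c : ℂ) (v : Cryptography.QReg n → ℂ) : pushIns hl (c • v) = c • pushIns hl v := by
  funext y
  simp only [pushIns, Pi.smul_apply, smul_eq_mul, Finset.mul_sum]
  refine Finset.sum_congr rfl fun p _ => ?_
  split_ifs <;> simp

/-- The push-forward of a basis state is the basis state of the inserted string. [folklore] -/
theorem pushIns_basisState (q : Cryptography.QReg n) : pushIns hl (Cryptography.basisState q) = Cryptography.basisState (insPair l hl q) := by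
  funext y
  by_cases hy : y ∈ Set.range (insPair l hl)
  · obtain ⟨p, rfl⟩ := hy
    rw [pushIns_insPair, Cryptography.basisState_apply, Cryptography.basisState_apply]
    by_cases h : p = q
    · rw [if_pos h, if_pos (by rw [h])]
    · rw [if_neg h, if_neg (fun h' => h (insPair_injective hl h'))]
  · rw [pushIns_of_not_range hl _ hy, Cryptography.basisState_apply, if_neg]
    rintro rfl; exact hy ⟨q, rfl⟩

/-- **Intertwining for the path-model generators**: `Φ_{i'} ∘ ins_* = ins_* ∘ Φ_i` for a generator
`i` not touching the new strands. [cite: AharonovJonesLandau2009, §3.1 eq. (3.1)] -/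
theorem ajlPhiC_expand_mulVec_pushIns (i : Fin (n - 1)) (hi2 : (i : ℕ) + 1 ≠ 2 * l) (v : Cryptography.QReg n → ℂ) :
    ajlPhiC 5 (n + 2) (expandGen l i) *ᵥ pushIns hl v = pushIns hl (ajlPhiC 5 n i *ᵥ v) := by
  funext y
  rw [Matrix.mulVec, dotProduct, sum_mul_pushIns hl]
  by_cases hy : y ∈ Set.range (insPair l hl)
  · obtain ⟨q, rfl⟩ := hy
    rw [pushIns_insPair, Matrix.mulVec, dotProduct]
    refine Finset.sum_congr rfl fun p _ => ?_
    dsimp only [ajlPhiC, Matrix.map_apply]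
    rw [ajlPhi_expand_insPair hl q p i hi2]
  · rw [pushIns_of_not_range hl _ hy]
    refine Finset.sum_eq_zero fun p _ => ?_
    dsimp only [ajlPhiC, Matrix.map_apply]
    rw [ajlPhi_expand_eq_zero_of_not_range hl hy p i hi2, Complex.ofReal_zero, zero_mul]

/-- **Intertwining for a crossing.** [cite: AharonovJonesLandau2009, Def. 2.6 and §3.1] -/
theorem ajlCrossingMatrix_expand_mulVec_pushIns (g : Fin (n - 1) × Bool) (hg : (g.1 : ℕ) + 1 ≠ 2 * l) (v : Cryptography.QReg n → ℂ) :
    ajlCrossingMatrix 5 (expandGen l g.1, g.2) *ᵥ pushIns hl v = pushIns hl (ajlCrossingMatrix 5 g *ᵥ v) := by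
  rw [ajlCrossingMatrix, ajlCrossingMatrix, Matrix.add_mulVec, Matrix.smul_mulVec, Matrix.smul_mulVec, Matrix.one_mulVec,
    Matrix.add_mulVec, Matrix.smul_mulVec, Matrix.smul_mulVec, Matrix.one_mulVec, pushIns_add, pushIns_smul, pushIns_smul]
  congr 2
  exact ajlPhiC_expand_mulVec_pushIns hl g.1 hg v

/-- **The word of the longer braid**: every letter re-indexed. [folklore] -/
def expandWord (l : ℕ) (b : BraidWord n) : BraidWord (n + 2) := b.map fun g => (expandGen l g.1, g.2)

/-- **Intertwining for words** none of whose letters touches the strands `2l, 2l+1` of the longer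
braid. [cite: AharonovJonesLandau2009, Cor. 3.1] -/
theorem ajlBraidMatrix_expandWord_mulVec_pushIns (b : BraidWord n) (hb : ∀ g ∈ b, (g.1 : ℕ) + 1 ≠ 2 * l)
    (v : Cryptography.QReg n → ℂ) :
    ajlBraidMatrix 5 (expandWord l b) *ᵥ pushIns hl v = pushIns hl (ajlBraidMatrix 5 b *ᵥ v) := by
  induction b generalizing v with
  | nil => simp [expandWord, ajlBraidMatrix_eq]
  | cons g b ih =>
    have hg : (g.1 : ℕ) + 1 ≠ 2 * l := hb g (by simp)
    have hb' : ∀ g' ∈ b, (g'.1 : ℕ) + 1 ≠ 2 * l := fun g' h => hb g' (by simp [h])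
    rw [ajlBraidMatrix_eq, expandWord, List.map_cons, List.map_cons, List.prod_cons, ← Matrix.mulVec_mulVec,
      ← expandWord, ← ajlBraidMatrix_eq, ih hb' v, ajlCrossingMatrix_expand_mulVec_pushIns hl g hg,
      Matrix.mulVec_mulVec, ajlBraidMatrix_eq 5 (g :: b), List.map_cons, List.prod_cons, ← ajlBraidMatrix_eq]

/-- **The `(α, α)` matrix element is unchanged**: `⟨α_{n+2}| φ(b') |α_{n+2}⟩ = ⟨α_n| φ(b) |α_n⟩`.
[cite: AharonovJonesLandau2009, Thm. 3.2 (proof)] -/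
theorem ajlBraidMatrix_expandWord_apply_alpha (b : BraidWord n) (hb : ∀ g ∈ b, (g.1 : ℕ) + 1 ≠ 2 * l) :
    ajlBraidMatrix 5 (expandWord l b) (ajlAlpha (n + 2)) (ajlAlpha (n + 2)) = ajlBraidMatrix 5 b (ajlAlpha n) (ajlAlpha n) := by
  have h1 := mulVec_basisState_apply' (ajlBraidMatrix 5 (expandWord l b)) (ajlAlpha (n + 2)) (ajlAlpha (n + 2))
  have h2 := mulVec_basisState_apply' (ajlBraidMatrix 5 b) (ajlAlpha n) (ajlAlpha n)
  rw [← h1, ← h2, ← insPair_ajlAlpha hl, ← pushIns_basisState hl, ajlBraidMatrix_expandWord_mulVec_pushIns hl b hb,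
    pushIns_insPair]

/-- **Inserting an untouched pair of strands does not change the AJL ratio** (`k = 5`, even
`n ≥ 2`). [cite: AharonovJonesLandau2009, Thm. 3.2] [cite: Kauffman1987, (⟨L ⊔ ◯⟩ = d⟨L⟩)] -/
theorem ajlRatio_expandWord (hn : Even n) (h2 : 2 ≤ n) (b : BraidWord n) (hb : ∀ g ∈ b, (g.1 : ℕ) + 1 ≠ 2 * l) :
    ajlRatio 5 (n + 2) (expandWord l b) = ajlRatio 5 n b := by
  rw [ajlRatio_eq_norm (by norm_num) (hn.add even_two) (by omega), ajlRatio_eq_norm (by norm_num) hn h2,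
    ajlBraidMatrix_expandWord_apply_alpha hl b hb]

end Push

/-! ### The deleting direction -/

section Compress

/-- The index of a generator of the longer braid inside the shorter one (a left inverse of
`expandIdx` on the generators not touching the deleted strands). [folklore] -/
def compressIdx (l j : ℕ) : ℕ := if j < 2 * l then j else j - 2

/-- `compressIdx` on generator indices (clamped, for totality; the clamp is inactive on the
generators not touching the deleted strands). [folklore] -/
def compressGen (h2 : 2 ≤ n) (l : ℕ) (j : Fin (n + 2 - 1)) : Fin (n - 1) :=
  ⟨min (compressIdx l j) (n - 2), by omega⟩

/-- **The compressed word**: delete the strands `2l, 2l+1` and re-index. [folklore] -/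
def compressWord (h2 : 2 ≤ n) (l : ℕ) (c : BraidWord (n + 2)) : BraidWord n :=
  c.map fun g => (compressGen h2 l g.1, g.2)

variable {l : ℕ} (hl : 2 * l ≤ n) (h2 : 2 ≤ n)
include hl

/-- Re-indexing back a compressed generator that does not touch the deleted strands. [folklore] -/
theorem expandGen_compressGen (j : Fin (n + 2 - 1)) (hj : (j : ℕ) + 1 ≠ 2 * l ∧ (j : ℕ) ≠ 2 * l ∧ (j : ℕ) ≠ 2 * l + 1) :
    expandGen l (compressGen h2 l j) = j := by
  have hjlt := j.2
  apply Fin.ext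
  simp only [expandGen_val, expandIdx, compressGen, compressIdx]
  split_ifs with a b b <;> omega

omit hl in
/-- A compressed generator does not touch the (former) position of the deleted strands. [folklore] -/
theorem compressGen_untouched (j : Fin (n + 2 - 1)) (hj : (j : ℕ) + 1 ≠ 2 * l ∧ (j : ℕ) ≠ 2 * l ∧ (j : ℕ) ≠ 2 * l + 1) :
    ((compressGen h2 l j : Fin (n - 1)) : ℕ) + 1 ≠ 2 * l := by
  have hjlt := j.2
  simp only [compressGen, compressIdx]
  split_ifs <;> omega

/-- A word not touching the strands `2l, 2l+1` is the expansion of its compression. [folklore] -/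
theorem expandWord_compressWord (c : BraidWord (n + 2))
    (hc : ∀ g ∈ c, (g.1 : ℕ) + 1 ≠ 2 * l ∧ (g.1 : ℕ) ≠ 2 * l ∧ (g.1 : ℕ) ≠ 2 * l + 1) :
    expandWord l (compressWord h2 l c) = c := by
  rw [expandWord, compressWord, List.map_map]
  conv_rhs => rw [← List.map_id c]
  refine List.map_congr_left fun g hg => ?_
  simp only [Function.comp_apply, id]
  rw [expandGen_compressGen hl h2 g.1 (hc g hg)]

/-- **Deleting an untouched pair of strands does not change the AJL ratio** (`k = 5`): for even
`n ≥ 2` and a braid word `c` on `n + 2` strands none of whose letters `σ_j^{±1}` has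
`j ∈ {2l−1, 2l, 2l+1}` (so that the strands `2l, 2l+1`, joined by a plat cap at each end, form a
separate unknotted circle), `ajlRatio 5 (n+2) c = ajlRatio 5 n (compressWord c)`. This is the
classical preprocessing that makes the binary-encoded strand number of `jonesApproxProblem`
harmless. [cite: AharonovJonesLandau2009, Thm. 3.2] [cite: Kauffman1987, (⟨L ⊔ ◯⟩ = d⟨L⟩)] -/
theorem ajlRatio_eq_ajlRatio_compressWord (hn : Even n) (c : BraidWord (n + 2))
    (hc : ∀ g ∈ c, (g.1 : ℕ) + 1 ≠ 2 * l ∧ (g.1 : ℕ) ≠ 2 * l ∧ (g.1 : ℕ) ≠ 2 * l + 1) :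
    ajlRatio 5 (n + 2) c = ajlRatio 5 n (compressWord h2 l c) := by
  conv_lhs => rw [← expandWord_compressWord hl h2 c hc]
  refine ajlRatio_expandWord hl hn h2 _ fun g hg => ?_
  rw [compressWord, List.mem_map] at hg
  obtain ⟨g', hg', rfl⟩ := hg
  exact compressGen_untouched h2 g'.1 (hc g' hg')

end Compress

end Literature.Computability.QuantumComplexity

end
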